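import Literature.Geometry.Lorentzian.InteriorKerrGluingInterpolation
import Literature.Geometry.Lorentzian.InteriorKerrGluingParameters
import Mathlib.Analysis.InnerProductSpace.Projection.Reflection
import HarnessLib

/-!
# Li–Mei Prop. 4.1 (`LiMei.interiorKerrGluing`) reduced to its analytic core

Support file (all results proved; no named facts) for the named fact `LiMei.interiorKerrGluing`
(`InteriorKerrGluing.lean`; J. Li, H. Mei, *A construction of collapsing spacetimes in vacuum*,
Comm. Math. Phys. 378 (2020) = arXiv:2005.01249, Prop. 4.1).

The printed proof (pp. 22–25) has an elementary shell and an analytic core: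

* shell — the cut-off pre-gluing `D̃(m, a⃗) = φ D + (1 − φ) D_{Kerr(m, a⃗)}` (first step, p. 22;
  `preGluedDatum`, `InteriorKerrGluingInterpolation.lean`), the degree argument producing a zero
  `(δm, a⃗)`, `|δm| + |a⃗| ≤ 2C₀ε`, of the obstruction map
  `𝓘(m, a⃗) = (8π(m − m₀), −8π m₀ a⃗) + (ε_α) + O(ε²)` (last step, p. 25;
  `Literature.Topology.Euclidean.Brouwer.exists_zero_linear_add_of_norm_le`, `obstructionLinear`,
  `kerrBox`), and the repackaging of the deformed datum into the conclusion
  (`conclusion_of_deformation`);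
* core — the Corvino–Schoen-type local deformation on the annulus modulo the four-dimensional
  cokernel spanned by the Killing initial data of the Schwarzschild cylinder, and the evaluation
  of the cokernel component `𝓘(m, a⃗)` by boundary integrals (pp. 23–25: weighted spaces, the
  linearised constraint map and its adjoint, [Corvino–Schoen 2006, Thm. 2], the KIDs `∂_t, Ω_i`,
  the integrals `𝓘_α`).

This file proves the shell once and for all: `interiorKerrGluing_of_core` derives the fact from an
explicit statement `core` of what the analytic core delivers for the concrete four-parameter
family `p = (δm, a⃗) ↦ D̃(M + δm, ‖a⃗‖, R_{a⃗})` (`R_{a⃗} = spinIsometry a⃗`, a rotation taking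
`a⃗/‖a⃗‖` to the axis `e₃` of the tree's Kerr–Schild charts), on the fixed radii
`gluingRadius ρ₁ ρ₂ j = ρ₁ + j(ρ₂ − ρ₁)/7`, `j = 1, …, 6`: an obstruction value
`𝓘(p) = L p + e + Q(p)` with `L = obstructionLinear M`, `‖e‖ ≤ C₁ε`, `Q` continuous with
`‖Q‖ ≤ C₂ε²` on the ball `‖p‖ ≤ C₀ε` (for every `C₀`, with `C₂, ε₂` depending on it — the printed
"if `ε` is sufficiently small"), such that `𝓘(p) = 0` yields a datum `D'` equal to `D̃(p)` off the
shell `{t₁ ≤ ‖y‖ ≤ t₂}` and vacuum on `{s₁ < ‖y‖ < s₂}`. Nothing is assumed about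
`interiorKerrGluing` itself; `core` is the conjunction of the outputs of Steps 2–5 of the printed
proof in the tree's vocabulary.

* `spinIsometry a⃗` — a linear isometry of `E3` with `spinIsometry a⃗ (a⃗/‖a⃗‖) = e₃`, the
  composition of two reflections (so orientation preserving), `= id` for `a⃗ = 0` or `a⃗ ∥ e₃`;
* `gluingRadius` — the six intermediate radii;
* `interiorKerrGluing_of_core` — **the reduction**.

## References

* J. Li, H. Mei, *A construction of collapsing spacetimes in vacuum*, Comm. Math. Phys. 378
  (2020), arXiv:2005.01249, Prop. 4.1 and its proof, pp. 22–25 (key `LiMei2020`).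
* J. Corvino, R. Schoen, *On the asymptotics for the vacuum Einstein constraint equations*,
  J. Differential Geom. 73 (2006), Thm. 2 (key `CorvinoSchoen2006`).
-/

noncomputable section

open Set Metric Filter Function Submodule
open scoped Manifold ContDiff Topology RealInnerProductSpace Real

namespace Literature.Geometry.Lorentzian

namespace LiMei

/-! ### A rotation taking the angular-momentum direction to the axis -/

/-- The axis `e₃ = (0, 0, 1)` of the tree's Kerr–Schild charts, as a vector of `E3`. [folklore] -/
def axisVec : E3 := EuclideanSpace.single 2 1

/-- The auxiliary direction `e₁ = (1, 0, 0)`. [folklore] -/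
def sideVec : E3 := EuclideanSpace.single 0 1

/-- `‖e₃‖ = 1`. [folklore] -/
@[simp]
theorem norm_axisVec : ‖axisVec‖ = 1 := by
  simp [axisVec]

/-- `e₃ ⊥ e₁`. [folklore] -/
theorem inner_sideVec_axisVec : ⟪sideVec, axisVec⟫ = 0 := by
  simp [sideVec, axisVec, EuclideanSpace.inner_single_left]

/-- `e₃` lies in the mirror `e₁ᗮ`. [folklore] -/
theorem axisVec_mem_orthogonal_sideVec : axisVec ∈ (ℝ ∙ sideVec)ᗮ :=
  (mem_orthogonal_singleton_iff_inner_right).2 inner_sideVec_axisVec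

/-- **A rotation taking `a⃗/‖a⃗‖` to the axis `e₃`**: the reflection in the bisecting mirror of
`a⃗/‖a⃗‖` and `e₃` followed by the reflection in the mirror `e₁ᗮ ∋ e₃` (two reflections: an
orientation-preserving isometry); the identity when `a⃗ = 0` or `a⃗/‖a⃗‖ = e₃`. With it the
tree's Kerr-cylinder data `kerrCylinderDatum m ‖a⃗‖ (spinIsometry a⃗)` (axis
`(spinIsometry a⃗)⁻¹ e₃ = a⃗/‖a⃗‖`) realise Li–Mei's four-parameter family
`(ḡ_{m,a⃗}, π̄_{m,a⃗})` ("obtained by a rotation", p. 25). [cite: LiMei2020, proof of Prop. 4.1, p. 25] -/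
def spinIsometry (b : E3) : E3 →ₗᵢ[ℝ] E3 :=
  if b = 0 ∨ ‖b‖⁻¹ • b = axisVec then LinearIsometry.id
  else (((ℝ ∙ (‖b‖⁻¹ • b - axisVec))ᗮ.reflection.trans
    (ℝ ∙ sideVec)ᗮ.reflection).toLinearIsometry)

/-- `spinIsometry 0 = id`. [folklore] -/
@[simp]
theorem spinIsometry_zero : spinIsometry 0 = LinearIsometry.id := by
  simp [spinIsometry]

/-- **`spinIsometry a⃗` maps the direction `a⃗/‖a⃗‖` to the axis `e₃`** (`a⃗ ≠ 0`).
[cite: LiMei2020, proof of Prop. 4.1, p. 25] -/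
theorem spinIsometry_apply_dir {b : E3} (hb : b ≠ 0) : spinIsometry b (‖b‖⁻¹ • b) = axisVec := by
  unfold spinIsometry
  by_cases hax : ‖b‖⁻¹ • b = axisVec
  · rw [if_pos (Or.inr hax), LinearIsometry.id_apply, hax]
  · rw [if_neg (not_or.2 ⟨hb, hax⟩)]
    have hn : ‖‖b‖⁻¹ • b‖ = ‖axisVec‖ := by
      rw [norm_smul, norm_inv, norm_norm, inv_mul_cancel₀ (norm_ne_zero_iff.2 hb), norm_axisVec]
    show (ℝ ∙ sideVec)ᗮ.reflection ((ℝ ∙ (‖b‖⁻¹ • b - axisVec))ᗮ.reflection (‖b‖⁻¹ • b)) = axisVec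
    rw [reflection_sub hn, reflection_mem_subspace_eq_self axisVec_mem_orthogonal_sideVec]

/-! ### The radii of the construction -/

/-- The intermediate radii `ρ₁ + j (ρ₂ − ρ₁)/7`: `s₁ < t₁ ≤ c₁ < c₂ ≤ t₂ < s₂` for `j = 1, …, 6`
(inner vacuum shell, deformation shell, cut-off shell). [cite: LiMei2020, proof of Prop. 4.1, p. 22] -/
def gluingRadius (ρ₁ ρ₂ : ℝ) (j : ℕ) : ℝ := ρ₁ + j * ((ρ₂ - ρ₁) / 7)

/-- The radii increase with `j` when `ρ₁ < ρ₂`. [folklore] -/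
theorem gluingRadius_lt_gluingRadius {ρ₁ ρ₂ : ℝ} (h : ρ₁ < ρ₂) {i j : ℕ} (hij : i < j) :
    gluingRadius ρ₁ ρ₂ i < gluingRadius ρ₁ ρ₂ j := by
  unfold gluingRadius
  have hd : 0 < (ρ₂ - ρ₁) / 7 := by linarith
  have hij' : (i : ℝ) < j := by exact_mod_cast hij
  nlinarith

/-- `gluingRadius ρ₁ ρ₂ 0 = ρ₁`. [folklore] -/
@[simp]
theorem gluingRadius_zero (ρ₁ ρ₂ : ℝ) : gluingRadius ρ₁ ρ₂ 0 = ρ₁ := by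
  simp [gluingRadius]

/-- `gluingRadius ρ₁ ρ₂ 7 = ρ₂`. [folklore] -/
@[simp]
theorem gluingRadius_seven (ρ₁ ρ₂ : ℝ) : gluingRadius ρ₁ ρ₂ 7 = ρ₂ := by
  simp [gluingRadius]; ring

/-! ### The reduction -/

/-- **Li–Mei Prop. 4.1 from its analytic core.** Suppose that for all admissible
`M, r₁, r₀, ρ₁, ρ₂` the analytic core of the printed proof holds for the concrete family
`p = (δm, a⃗) ↦ D̃(p) = preGluedDatum (M + δm) ‖a⃗‖ (spinIsometry a⃗)` with cut-off radii
`c₁ = gluingRadius ρ₁ ρ₂ 3 < c₂ = gluingRadius ρ₁ ρ₂ 4` and time shift `0`: there are `k`, `C₁ ≥ 0`,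
`ε₁ > 0` and, for every `C₀ ≥ 0`, constants `C₂ ≥ 0`, `ε₂ > 0` such that for `0 < ε ≤ min ε₁ ε₂`
and every `D` vacuum on `A = {ρ₁ < ‖y‖ < ρ₂}` and `ε`-close to the Schwarzschild(`M`) cylinder in
`C^k(A)`, the obstruction takes the form `𝓘(p) = L p + e + Q(p)` (`L = obstructionLinear M`,
`‖e‖ ≤ C₁ε`, `Q` continuous with `‖Q(p)‖ ≤ C₂ε²` on `‖p‖ ≤ C₀ε` — Li–Mei p. 25,
"`𝓘(m, a⃗) = (8π(m − m₀), −8π m₀ a⃗) + (ε₀, …, ε₃) + O(ε²)`") and each zero `p` of `𝓘` in that ball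
with admissible parameters yields a datum `D'` equal to `D̃(p)` off the shell
`{t₁ ≤ ‖y‖ ≤ t₂}` (`t = gluingRadius ρ₁ ρ₂ 2, 5`) and vacuum on `{s₁ < ‖y‖ < s₂}`
(`s = gluingRadius ρ₁ ρ₂ 1, 6`) — the Corvino–Schoen deformation with the cokernel absorbed
(pp. 23–25). THEN `LiMei.interiorKerrGluing` holds: the degree step
(`exists_zero_linear_add_of_norm_le` with `C₀ = 2‖L⁻¹‖C₁ + 1`), the parameter box (`kerrBox`) and
the repackaging (`conclusion_of_deformation`) supply the conclusion with `C = 2C₀`,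
`m = M + δm`, `a = ‖a⃗‖`, `R = spinIsometry a⃗`, `σ₁ = s₁`, `σ₂ = s₂`.
[cite: LiMei2020, proof of Prop. 4.1, pp. 22–25] -/
theorem interiorKerrGluing_of_core
    (core : ∀ [Kerr.Facts] (M r₁ r₀ ρ₁ ρ₂ : ℝ), 0 < r₁ → r₁ < r₀ → r₀ < 2 * M → 1 ≤ ρ₁ → ρ₁ < ρ₂ →
      ∃ (k : ℕ) (C₁ ε₁ : ℝ), 0 ≤ C₁ ∧ 0 < ε₁ ∧ ∀ C₀ : ℝ, 0 ≤ C₀ → ∃ (C₂ ε₂ : ℝ), 0 ≤ C₂ ∧ 0 < ε₂ ∧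
        ∀ ε : ℝ, 0 < ε → ε ≤ ε₁ → ε ≤ ε₂ → ∀ D : InitialDataSet (𝓡 3) E3,
          IsVacuumOn {y : E3 | ρ₁ < ‖y‖ ∧ ‖y‖ < ρ₂} D →
          NearSchwarzschildCylinder M r₁ r₀ ρ₁ ρ₂ k ε D →
          ∃ (e : ℝ × E3) (Q : ℝ × E3 → ℝ × E3), ‖e‖ ≤ C₁ * ε ∧
            ContinuousOn Q (closedBall (0 : ℝ × E3) (C₀ * ε)) ∧
            (∀ p ∈ closedBall (0 : ℝ × E3) (C₀ * ε), ‖Q p‖ ≤ C₂ * ε ^ 2) ∧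
            ∀ p ∈ closedBall (0 : ℝ × E3) (C₀ * ε), obstructionLinear M p + e + Q p = 0 →
              ∀ (ha : |‖p.2‖| < M + p.1) (h₁ : Kerr.rMinus (M + p.1) ‖p.2‖ < r₀)
                (h₂ : r₀ < Kerr.rPlus (M + p.1) ‖p.2‖),
                ∃ D' : InitialDataSet (𝓡 3) E3,
                  (∀ y : E3, (‖y‖ < gluingRadius ρ₁ ρ₂ 2 ∨ gluingRadius ρ₁ ρ₂ 5 < ‖y‖) →
                    D'.h.inner y = (preGluedDatum ha h₁ h₂ 0 (spinIsometry p.2)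
                      (gluingRadius ρ₁ ρ₂ 3) (gluingRadius ρ₁ ρ₂ 4) D).h.inner y ∧
                    D'.k y = (preGluedDatum ha h₁ h₂ 0 (spinIsometry p.2)
                      (gluingRadius ρ₁ ρ₂ 3) (gluingRadius ρ₁ ρ₂ 4) D).k y) ∧
                  IsVacuumOn {y : E3 | gluingRadius ρ₁ ρ₂ 1 < ‖y‖ ∧ ‖y‖ < gluingRadius ρ₁ ρ₂ 6}
                    D') :
    interiorKerrGluing := by
  intro inst M r₁ r₀ ρ₁ ρ₂ hr₁ hr₁₀ h2M hρ₁ hρ₁₂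
  have hr₀ : 0 < r₀ := hr₁.trans hr₁₀
  have hM : M ≠ 0 := by
    intro h; rw [h, mul_zero] at h2M; linarith
  obtain ⟨k, C₁, ε₁, hC₁, hε₁, core₁⟩ := core M r₁ r₀ ρ₁ ρ₂ hr₁ hr₁₀ h2M hρ₁ hρ₁₂
  -- the constants of the degree step
  set L : (ℝ × E3) ≃L[ℝ] ℝ × E3 := obstructionLinearEquiv hM with hL
  set N : ℝ := ‖(L.symm : ℝ × E3 →L[ℝ] ℝ × E3)‖ with hN
  have hN0 : 0 ≤ N := norm_nonneg _
  set C₀ : ℝ := 2 * N * C₁ + 1 with hC₀_def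
  have hC₀ : 0 ≤ C₀ := by positivity
  obtain ⟨C₂, ε₂, hC₂, hε₂, core₂⟩ := core₁ C₀ hC₀
  obtain ⟨δ, hδ, hbox⟩ := kerrBox hr₀ h2M
  refine ⟨k, 2 * C₀, min (min ε₁ ε₂) (min (2 * N * C₂ + 1)⁻¹ (δ / (2 * C₀ + 1))),
    by positivity, fun ε hε hεε D hvac hnear ↦ ?_⟩
  have hεε₁ : ε ≤ ε₁ := hεε.trans ((min_le_left _ _).trans (min_le_left _ _))
  have hεε₂ : ε ≤ ε₂ := hεε.trans ((min_le_left _ _).trans (min_le_right _ _))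
  have hεN : ε ≤ (2 * N * C₂ + 1)⁻¹ := hεε.trans ((min_le_right _ _).trans (min_le_left _ _))
  have hεδ : ε ≤ δ / (2 * C₀ + 1) := hεε.trans ((min_le_right _ _).trans (min_le_right _ _))
  obtain ⟨e, Q, he, hQc, hQ, hdef⟩ := core₂ ε hε hεε₁ hεε₂ D hvac hnear
  -- the degree step: a zero `p` of `L p + e + Q p` with `‖p‖ ≤ C₀ ε`
  have hNC : N * (C₁ + C₂ * ε) ≤ C₀ := by
    have h1 : N * C₂ * ε ≤ 2⁻¹ := by
      have hden : 0 < 2 * N * C₂ + 1 := by positivity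
      have h2 : N * C₂ * ε ≤ N * C₂ * (2 * N * C₂ + 1)⁻¹ :=
        mul_le_mul_of_nonneg_left hεN (by positivity)
      have h3 : N * C₂ * (2 * N * C₂ + 1)⁻¹ ≤ 2⁻¹ := by
        rw [← div_eq_mul_inv, div_le_iff₀ hden]
        nlinarith
      exact h2.trans h3
    have h4 : N * C₁ ≤ 2 * N * C₁ := by nlinarith
    calc N * (C₁ + C₂ * ε) = N * C₁ + N * C₂ * ε := by ring
      _ ≤ 2 * N * C₁ + 2⁻¹ := add_le_add h4 h1
      _ ≤ C₀ := by rw [hC₀_def]; norm_num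
  obtain ⟨p, hp, hzero⟩ :=
    Literature.Topology.Euclidean.Brouwer.exists_zero_linear_add_of_norm_le L hε.le hC₀ hNC he
      hQc hQ
  have hzero' : obstructionLinear M p + e + Q p = 0 := by
    rw [hL, coe_obstructionLinearEquiv] at hzero
    exact hzero
  -- the parameters lie in the box
  have hpn : ‖p‖ ≤ C₀ * ε := mem_closedBall_zero_iff.1 hp
  have hsum : |p.1| + ‖p.2‖ ≤ 2 * C₀ * ε := by
    have h := abs_add_norm_le_two_mul_norm p
    nlinarith
  have h2C : 2 * C₀ * ε ≤ δ := by
    have h1 : 2 * C₀ * ε ≤ (2 * C₀ + 1) * ε := by nlinarith [hε.le]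
    have h2 : (2 * C₀ + 1) * ε ≤ δ := by
      rw [le_div_iff₀ (by positivity)] at hεδ
      linarith
    linarith
  obtain ⟨ha, h₁, h₂⟩ := hbox (M + p.1) ‖p.2‖ (by
    calc |M + p.1 - M| + |‖p.2‖| = |p.1| + ‖p.2‖ := by rw [add_sub_cancel_left, abs_norm]
      _ ≤ δ := hsum.trans h2C)
  -- the deformation and the repackaging
  obtain ⟨D', hagree, hvac'⟩ := hdef p hp hzero' ha h₁ h₂
  have hlt : ∀ {i j : ℕ}, i < j → gluingRadius ρ₁ ρ₂ i < gluingRadius ρ₁ ρ₂ j :=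
    fun hij ↦ gluingRadius_lt_gluingRadius hρ₁₂ hij
  have hs₁ : ρ₁ < gluingRadius ρ₁ ρ₂ 1 := by
    simpa using (hlt (i := 0) (j := 1) zero_lt_one)
  have hs₂ : gluingRadius ρ₁ ρ₂ 6 < ρ₂ := by
    simpa using (hlt (i := 6) (j := 7) (by norm_num))
  obtain ⟨hin, hvacD', hK⟩ := conclusion_of_deformation ha h₁ h₂ 0 (spinIsometry p.2) hρ₁ hs₁
    (hlt (by norm_num : 1 < 2)) (hlt (by norm_num : 2 < 3)).le (hlt (by norm_num : 3 < 4))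
    (hlt (by norm_num : 4 < 5)).le (hlt (by norm_num : 5 < 6)) hvac hagree hvac'
  refine ⟨D', M + p.1, ‖p.2‖, 0, gluingRadius ρ₁ ρ₂ 1, gluingRadius ρ₁ ρ₂ 6, spinIsometry p.2,
    ?_, ha, h₁, h₂, hs₁, hlt (by norm_num : 1 < 6), hs₂, hin, hvacD', hK⟩
  calc |M + p.1 - M| + |‖p.2‖| = |p.1| + ‖p.2‖ := by rw [add_sub_cancel_left, abs_norm]
    _ ≤ 2 * C₀ * ε := hsum

end LiMei

end Literature.Geometry.Lorentzian

end
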